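import Literature.AlgebraicGeometry.Resolution.Blowups
import HarnessLib

/-!
# Stalks of two blowing ups along the same centre agree

Support file for crux stmt-ResolutionOfSingularities-15315
(`FrobeniusLadder.FInjectiveMacaulayfication`, line `Sketch`, seat c6): stub
`stub_isBlowupStalkTransfer` (W3-3, surgery glue piece).

Let `π : X' → X` and `π' : X'' → X` be two blowing ups of the same scheme `X` along the same
ideal sheaf `J`, in the sense of the universal property (`IsBlowup`,
`Literature/AlgebraicGeometry/Resolution/Blowups.lean`, Görtz–Wedhorn I, Def. 13.90). By
uniqueness of blowing ups (`IsBlowup.unique`, GW I, (13.19)) there is an isomorphism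
`e : X' ≅ X''` over `X`, i.e. `e.hom ≫ π' = π`. For a point `x' ∈ X'` put `x'' := e.hom x'`;
then `π' x'' = π x'`, and the stalk map of the isomorphism `e.hom` at `x'` is an isomorphism
`𝒪_{X'', x''} ≅ 𝒪_{X', x'}`.

* `stub_isBlowupStalkTransfer` — every stalk of `X'` is ring-isomorphic to a stalk of `X''` at a
  point with the same image in `X`.

References: U. Görtz, T. Wedhorn, *Algebraic Geometry I*, 2nd ed. (2020), Def. 13.90 and
(13.19) p. 413; folklore (stalk maps of isomorphisms are isomorphisms).
-/

-- single-problem summit: the doubled namespace component is forced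
set_option linter.dupNamespace false

noncomputable section

namespace Summit.ResolutionOfSingularities.ResolutionOfSingularities.Theorems.FInjectiveMacaulayfication.IsBlowupStalkTransfer

open AlgebraicGeometry CategoryTheory Literature.AlgebraicGeometry.Resolution

/-- W3-3 STALK TRANSFER BETWEEN TWO BLOW-UPS: if `π : X' → X` and `π' : X'' → X` are both
blow-ups of `X` along the same ideal sheaf `J` (universal property, `IsBlowup`), then for every
point `x' ∈ X'` there is a point `x'' ∈ X''` over the same point of `X` with
`𝒪_{X', x'} ≃+* 𝒪_{X'', x''}`: take `x'' := e x'` for the isomorphism `e : X' ≅ X''` over `X`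
of `IsBlowup.unique`, whose stalk map at `x'` is an isomorphism.
[cite: GortzWedhorn2020, (13.19) p. 413] -/
theorem stub_isBlowupStalkTransfer : ∀ (X X' X'' : Scheme.{0}) (J : X.IdealSheafData) (π : X' ⟶ X) (π' : X'' ⟶ X),
    IsBlowup π J → IsBlowup π' J → ∀ x' : X', ∃ x'' : X'', π'.base x'' = π.base x' ∧
      Nonempty (X'.presheaf.stalk x' ≃+* X''.presheaf.stalk x'') := by
  intro X X' X'' J π π' hπ hπ' x'
  obtain ⟨e, he, -⟩ := hπ.unique hπ'
  refine ⟨e.hom.base x', ?_, ⟨(asIso (e.hom.stalkMap x')).commRingCatIsoToRingEquiv.symm⟩⟩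
  change (e.hom ≫ π').base x' = π.base x'
  rw [he]

end Summit.ResolutionOfSingularities.ResolutionOfSingularities.Theorems.FInjectiveMacaulayfication.IsBlowupStalkTransfer

end
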